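import Summits.AtomisticToContinuum.BoseEinsteinCondensation.Theses.BECGroundStateSOS
import Literature.MathematicalPhysics.QuantumLattice.XYOrderInfrared
import Literature.MathematicalPhysics.QuantumLattice.PerronFrobeniusGroundState

/-!
# Sketch — crux-ideate round 1 (ideator 1) for `LatticeODLROOffHalfFilling`
(item stmt-AtomisticToContinuum-11033, route BECGroundStateSOS)

First lemmas of the idea cards (they must ELABORATE; proofs are not required here):

* card `perron-cone-certificates`  — `PerronConeNonneg`, `PerronConeSoundness`
* card `vacancy-residue-overlap`   — `VacancyResidueBound`
* shared Transfer target C⁺        — `DopedGaussianDomination κ` and the composition shape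
  `DopedGaussianDomination κ → κ < 4 → LatticeODLROOffHalfFilling` (to become `stub_transfer`).
-/

namespace Summit.AtomisticToContinuum.BoseEinsteinCondensation.Cruxes.LatticeODLROOffHalfFilling.Sketch

open Matrix Complex Finset
open Literature.MathematicalPhysics.QuantumLattice Literature.Probability.LatticeModels
open Summit.AtomisticToContinuum.BoseEinsteinCondensation.Theses.BECGroundStateSOS

noncomputable section

/-- The doped hard-core boson Hamiltonian `H_μ = -Σ_{⟨xy⟩}(S¹S¹+S²S²) - μ S³_tot` on the torus
`(ℤ/Lℤ)³`, spin ½ — literally the operator inside the crux `LatticeODLROOffHalfFilling`. -/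
abbrev dopedXY (L : ℕ) [NeZero L] (μ : ℝ) : Op (TorusSite 3 L) 2 :=
  xxzHamiltonian 1 (torusGraph 3 L) (-1) 0 - (μ : ℂ) • totalSpin 1 2

/-- Entrywise nonnegative (real) operator in the occupation (`TensorIndex`) basis — the Perron
cone `K₊`. -/
def IsEntrywiseNonneg {Λ : Type*} [Fintype Λ] [DecidableEq Λ] {q : ℕ} (P : Op Λ q) : Prop :=
  ∀ σ τ : TensorIndex Λ q, (P σ τ).im = 0 ∧ 0 ≤ (P σ τ).re

/-- FIRST LEMMA of card `perron-cone-certificates`: stoquasticity survives doping. For every side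
`L`, every chemical potential `μ` and every entrywise-nonnegative `P`, the tracial ground-state
functional of `H_μ` is nonnegative on `P` (each sector ground state is a Perron vector of the
token graph of the torus; the ground projector is entrywise `≥ 0`). Provable from
`perronFrobenius_groundState_pos` + connectivity of the sector hopping graphs. -/
def PerronConeNonneg : Prop :=
  ∀ (L : ℕ) [NeZero L] (μ : ℝ) (P : Op (TorusSite 3 L) 2), IsEntrywiseNonneg P →
    0 ≤ ((dopedXY L μ).groundStateFunctional P).re

/-- Soundness of the ENLARGED certificate cone (SOS + ground-state commutator cone + stationarity
+ Perron cone): if `c·1 - O = Σ Bⱼᴴ Bⱼ + Σ Aᵢᴴ (H Aᵢ - Aᵢ H) + (H C - C H) + P` with `P ∈ K₊`,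
then `ω_μ(O) ≤ c`. (The first three summands are the route's cone; `P` is the new lever.) -/
def PerronConeSoundness : Prop :=
  ∀ (L : ℕ) [NeZero L] (μ c : ℝ) (O P C : Op (TorusSite 3 L) 2)
    (ιB ιA : Type) [Fintype ιB] [Fintype ιA] (B : ιB → Op (TorusSite 3 L) 2) (A : ιA → Op (TorusSite 3 L) 2),
    IsEntrywiseNonneg P →
    (c : ℂ) • (1 : Op (TorusSite 3 L) 2) - O =
      (∑ j, (B j)ᴴ * B j) + (∑ i, (A i)ᴴ * (dopedXY L μ * A i - A i * dopedXY L μ)) +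
        (dopedXY L μ * C - C * dopedXY L μ) + P →
    ((dopedXY L μ).groundStateFunctional O).re ≤ c

/-- A vector on the spin-½ torus is translation invariant. -/
def IsTranslationInvariant {L : ℕ} (ψ : TensorIndex (TorusSite 3 L) 2 → ℂ) : Prop :=
  ∀ (a : TorusSite 3 L) (σ : TensorIndex (TorusSite 3 L) 2), ψ (fun x => σ (x + a)) = ψ σ

/-- FIRST LEMMA of card `vacancy-residue-overlap` (lossless Bessel step on the torus): for unit,
translation-invariant vectors `ψ` (sector `M`) and `φ` (sector `M-1`), the ODLRO double sum
`⟨ψ, S⁺_tot S⁻_tot ψ⟩ = Σ_{x,y} ⟨a†_x a_y⟩` dominates `|Λ|² |⟨φ, a_x ψ⟩|²` at ANY site `x`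
(`a_x = S⁻_x = S¹_x - i S²_x`). Pure linear algebra: `‖S⁻_tot ψ‖² ≥ |⟨φ, S⁻_tot ψ⟩|²` and
`⟨φ, S⁻_y ψ⟩` is independent of `y`. -/
def VacancyResidueBound : Prop :=
  ∀ (L : ℕ) [NeZero L] (ψ φ : TensorIndex (TorusSite 3 L) 2 → ℂ) (x : TorusSite 3 L),
    star ψ ⬝ᵥ ψ = 1 → star φ ⬝ᵥ φ = 1 → IsTranslationInvariant ψ → IsTranslationInvariant φ →
    ((Fintype.card (TorusSite 3 L) : ℝ) ^ 2) *
        Complex.normSq (star φ ⬝ᵥ ((siteSpin 1 x 0 - Complex.I • siteSpin 1 x 1) *ᵥ ψ)) ≤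
      (star ψ ⬝ᵥ (((totalSpin 1 0 + Complex.I • totalSpin 1 1) *
          (totalSpin 1 0 - Complex.I • totalSpin 1 1)) *ᵥ ψ)).re

/-- TRANSFER TARGET C⁺ shared by the cards: doped ground-state Gaussian domination with loss
factor `κ` (`κ = 1` is exact Gaussian domination; KLS's slack in `d = 3` affords any `κ < 4`):
for `|μ| < μ₀`, even `L ≥ 4` and every real field `h`,
`E₀(H_μ) ≤ E₀(H_μ - V_h + κ Q_h / 2)` in the notation of `XYOrderInfrared`
(`xyGradField`, `xyFieldEnergy`). Via the tree's generic `groundState_infraredBound` this is the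
μ-deformed infrared bound (A_μ) with factor `κ`. -/
def DopedGaussianDomination (κ : ℝ) : Prop :=
  ∃ μ₀ : ℝ, 0 < μ₀ ∧ ∀ μ : ℝ, |μ| < μ₀ → ∀ (L : ℕ) [NeZero L], Even L → 4 ≤ L →
    ∀ h : TorusSite 3 L → ℝ,
      (dopedXY L μ).groundEnergy ≤
        (dopedXY L μ - xyGradField L 1 h +
          ((κ * xyFieldEnergy L h / 2 : ℝ) : ℂ) • (1 : Op (TorusSite 3 L) 2)).groundEnergy

/-- Shape of the future `stub_transfer`: `C⁺ → crux` (any `κ < 4`). -/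
def TransferShape : Prop :=
  ∀ κ : ℝ, κ < 4 → DopedGaussianDomination κ → LatticeODLROOffHalfFilling

/-- Sanity: at `κ = 1`, `μ = 0` the transfer hypothesis is the tree's (proved) KLS Gaussian
domination specialised to `d = 3`, spin ½ (`xyFieldHamiltonian`). -/
example (L : ℕ) [NeZero L] (h : TorusSite 3 L → ℝ) :
    dopedXY L 0 - xyGradField L 1 h + (((1 : ℝ) * xyFieldEnergy L h / 2 : ℝ) : ℂ) • (1 : Op (TorusSite 3 L) 2)
      = xyFieldHamiltonian L 1 h := by
  simp [dopedXY, xyFieldHamiltonian, xyTorus]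

end

end Summit.AtomisticToContinuum.BoseEinsteinCondensation.Cruxes.LatticeODLROOffHalfFilling.Sketch
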